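import Literature.MathematicalPhysics.QuantumFieldTheory.Volkov2017.SectorIntegral
import HarnessLib

/-!
# Volkov's Lemma 1 (PRD 96 §III.C, `lemma_sum_to_max`): the projective change of variables between the simplex form `∫ h δ(Σz − 1) dz` and the affine chart `z_{j₁} = 1`, with its Jacobian (20) `= 1/(1 + y₂ + … + y_n)ⁿ` — PROVED; and with it the printed evaluation of (19), the simplex-sector integral of the Hepp-sector density `g₀`, `= 1/∏_l Deg`

independent recomputation; certified where stated, statistical where stated; no new-physics claim.

CITATION HEADER (venture `QEDPrecision`, cell `pub-qed`, track TROPICAL seat V3a = `pub-qed-trop-v3-lit-1` gen 12; VALUE-FREE: a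
change-of-variables identity and an elementary integral in the symbols `Deg(s) > 0`; no constant, nothing per graph, per word or per Set V
family). Companion of `SectorIntegral.lean` (same seat, gen 8), which typed the SECOND half of Volkov's sentence — the affine-chart integral
"equals 1/∏ Deg" by the substitution (22) — and listed as NOT typed "Lemma 1 itself (the passage from the simplex δ(Σz − 1) form (19) to the
affine chart y₁ = 1 — Volkov's own lemma with the Jacobian (20))". This file types Lemma 1 with its printed proof (the Jacobian is a rank-one
update of a multiple of the identity) and closes the chain (19) = [affine-chart integral] = 1/∏ Deg. Serves `tropical/view/V3-VOLKOV-DEGREES.md`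
§A A.2.3 ("exact normalisation 1/∏_l Deg(s^{[l]}) per sector") and A.26.3 (α) ("the simplex ↔ sector-cube change of variables as a Lean
theorem" — listed there and in A.28.2 as prose only).

Source [Volkov2017]: S. Volkov, "New method of computing the contributions of graphs without lepton loops to the electron anomalous magnetic
moment in QED", Phys. Rev. D 96, 096018 (2017) = arXiv:1705.05800v4 (e-print `amm4_mc_arxiv.tex` held on the cell's HOME under
`data/lit/sources/.cache/1705.05800/`, sha256 3d5fd6a7…; §III.C = arXiv PDF p.17–18; equation numbers counted from the e-print's numbered
`equation` environments, LaTeX labels given), VERBATIM: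
* §II.C (12) `eq_feyn_param_integral`: "Calculation of a graph G contribution to a_{e,1}^{new} can be reduced to the Feynman-parametric
  integration ∫_{z₁,…,z_n>0} I(z₁,…,z_n) δ(z₁+…+z_n−1) dz₁…dz_n."
* §III.B: "Each sector corresponds to a permutation (j₁,…,j_n) of {1,2,…,n} and is defined by S_{j₁,…,j_n} = {(z₁,…,z_n) ∈ ℝ :
  z_{j₁} ≥ z_{j₂} ≥ … ≥ z_{j_n}}. We define the function g₀(z₁,…,z_n) on S_{j₁,…,j_n} by the following relation
  (16) `eq_mc_g0`: g₀(z₁,…,z_n) = ∏_{l=2}^{n} (z_{j_l}/z_{j_{l−1}})^{Deg({j_l,j_{l+1},…,j_n})} / (z₁z₂…z_n), where Deg(s) > 0 is defined for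
  each set s of internal lines of G except the empty set and the set of all internal lines of G."
* §III.C "Fast sampling algorithm", Preliminaries (tex l.856–933): "To generate sectors with correct probabilities it is required to know
  the value (19) `eq_g0_integral`: ∫_{z₁,…,z_n>0, (z₁,…,z_n)∈S_{j₁,…,j_n}} g₀(z₁,…,z_n) δ(z₁+…+z_n−1) dz₁…dz_n […] for each sector
  S_{j₁,…,j_n}. The following lemma is used for obtaining this integral.
  LEMMA 1 (`lemma_sum_to_max`). Let Y ⊆ ℝ^{n−1}, X be the image of Y under the map (y₂,…,y_n) → (y₂/(1+y₂+…+y_n), …,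
  y_n/(1+y₂+…+y_n)), h : ℝⁿ → ℝ be a function satisfying h(k z) = h(z)/kⁿ. Then ∫_Y h(1,y₂,…,y_n) dy₂…dy_n =
  ∫_X h(1−x₂−…−x_n, x₂,…,x_n) dx₂…dx_n.
  Proof. Let us use the substitution x_j = y_j/(1+y₂+…+y_n). To apply the change of variables theorem we should prove the following
  relation for the Jacobian: (20) `eq_jacobian` |∂(x₂,…,x_n)/∂(y₂,…,y_n)| = h(1,y₂,…,y_n)/h(1−x₂−…−x_n,x₂,…,x_n). The right part of (20)
  equals 1/(1+y₂+…+y_n)ⁿ. The left part equals |D|, where D = det(M′+M″), m′_{ij} = δ_{ij}/(1+y₂+…+y_n), m″_{ij} = −y_i/(1+y₂+…+y_n)²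
  […] d_l = 0 for l ≥ 2, because all rows of M″ are collinear […] d₀ = det M′ = 1/(1+y₂+…+y_n)^{n−1} […] d₁ = −(y₂+…+y_n)/(1+y₂+…+y_n)ⁿ.
  Thus, D = d₀+d₁ = 1/(1+y₂+…+y_n)ⁿ. This completes the proof.
  Using the proved lemma and the substitution (21) `eq_subst_zy` z_{j_l} = y_l/(1+y₂+…+y_n), 1 ≤ l ≤ n, where y₁ = 1, we obtain that (19)
  equals ∫_{1 ≥ y₂ ≥ y₃ ≥ … ≥ y_n > 0} ∏_{l=2}^{n} (y_l/y_{l−1})^{Deg({j_l,j_{l+1},…,j_n})} / (y₂…y_n) dy₂…dy_n. By the substitution (22)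
  `eq_subst_yt` t_l = y_l/y_{l−1} we obtain that it equals 1/∏_{l=2}^{n} Deg({j_l,j_{l+1},…,j_n})."

What is typed (all PROVED; Mathlib + the tree's `Borinsky2020/HeppSectorCoordinates` and `Volkov2017/SectorIntegral` only). Throughout
`d = n − 1` is the number of free variables, a point of `ℝⁿ` is `Fin (d + 1) → ℝ`, Volkov's `(1, y₂, …, y_n)` is `Fin.cons 1 y` and his
`(1 − x₂ − … − x_n, x₂, …, x_n)` is `Fin.cons (1 − Σ x) x` — i.e. the δ-function of (12)/(19) is resolved in the FIRST listed coordinate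
(`z_{j₁}`, the largest one on the sector), which is how a `δ(Σz − 1)` integral is read as a Lebesgue integral over `ℝ^{n−1}`.
* §1 `maxToSum y = y/(1 + Σ y)` (def; the map of Lemma 1 = the substitution (21) read on the last `n − 1` coordinates) and its inverse
  `sumToMax x = x/(1 − Σ x)` (def); `sumToMax_maxToSum`, `maxToSum_sumToMax`, `injOn_maxToSum` (injective wherever `1 + Σ y ≠ 0` — the
  lemma needs no positivity for this), `image_maxToSum` / `image_maxToSum_of_pos` (Volkov's "X, the image of Y": `X = {x | Σ x < 1,
  x/(1 − Σ x) ∈ Y}`), and the point identity `cons_one_sub_sum_maxToSum`: `(1 − Σ x, x) = (1, y)/(1 + Σ y)` at `x = maxToSum y`.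
* §2 THE JACOBIAN (20): `maxToSumDeriv y` (def, the Fréchet derivative `v ↦ v/(1+Σy) − (Σ v) y/(1+Σy)²`, i.e. Volkov's `M′ + M″`),
  `hasFDerivAt_maxToSum`, `toMatrix_maxToSumDeriv` (its matrix is `(1+Σy)⁻¹ • (1 + u ⊗ 𝟙)` with `u = −y/(1+Σy)`: "all rows of M″ are
  collinear"), and **`det_maxToSumDeriv : det = ((1 + Σ y)^{d+1})⁻¹`** — "D = d₀ + d₁ = 1/(1+y₂+…+y_n)ⁿ", here by the rank-one
  determinant lemma `det(1 + u ⊗ v) = 1 + v ⬝ u` (Mathlib's `Matrix.det_one_add_replicateCol_mul_replicateRow`), which is exactly the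
  content of Volkov's expansion `d_l = 0 (l ≥ 2)`, `d₀`, `d₁`.
* §3 THE CHANGE OF VARIABLES. **`setIntegral_image_maxToSum`**: for EVERY `f : ℝⁿ → F` (Banach-space valued, no homogeneity) and every
  measurable `Y ⊆ {1 + Σ y > 0}`, `∫_{x ∈ maxToSum '' Y} f(1 − Σx, x) dx = ∫_{y ∈ Y} ((1+Σy)^{d+1})⁻¹ • f((1, y)/(1 + Σ y)) dy` (Mathlib's
  `integral_image_eq_integral_abs_det_fderiv_smul`), with the matching integrability transfer **`integrableOn_image_maxToSum_iff`** (so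
  FINITENESS statements move between the two charts, not only values); then **`integral_cons_one_eq_integral_image_maxToSum`** = LEMMA 1 AS
  PRINTED: if `h(k z) = h(z)/kⁿ` for `k > 0` at the points `z = (1, y)`, `y ∈ Y` (Volkov: for all `z`; only these are used), then
  `∫_Y h(1, y) dy = ∫_X h(1 − Σx, x) dx` with `X = maxToSum '' Y`; `integral_cons_one_eq_of_homogeneous` is the verbatim global-hypothesis
  form. Hypotheses made explicit that the print leaves implicit: `Y` measurable, `1 + Σ y > 0` on `Y` (true on Volkov's `Y ⊆ {y > 0}`),
  `k > 0` in the homogeneity.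
* §4 THE SECTOR. `sectorChartY m = {1 ≥ y₂ ≥ … ≥ y_n > 0}` (def; `m + 1 = n − 1` free coordinates, Volkov's order: `y 0 = y₂` is the largest)
  and `simplexSectorChart m = {x | (1 − Σ x, x) ∈ S_{1,2,…,n}, all coordinates > 0}` (def: the integration domain of (19) for the sector
  `z₁ ≥ z₂ ≥ … ≥ z_n` of the open orthant, δ resolved in `z₁`); **`simplexSectorChart_eq_image`**: it IS `maxToSum '' sectorChartY` (the
  hypothesis "X be the image of Y" of Lemma 1, discharged for the use Volkov makes of it); `sectorChartY_eq_preimage_heppCube`: in the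
  tree's increasing Hepp convention `sectorChartY` is the coordinate-reversal of `Borinsky2020.heppCube`, whence `measurableSet_sectorChartY`
  and `setIntegral_sectorChartY_eq_heppCube` (relabelling preserves Lebesgue measure, `Borinsky2020.measurePreserving_permCoords`).
* §5 THE EVALUATION OF (19). `g0Fund D z = (∏_{i} (z_{i+1}/z_i)^{D i}) / ∏_j z_j` (def) = (16) on the sector `S_{1,2,…,n}` (0-based: the
  ratio `z_{i+1}/z_i`, `i = 0, …, n − 2`, carries `D i = Deg({i+2, …, n})` in Volkov's 1-based line labels — for a general sector
  `S_{j₁,…,j_n}` relabel the lines by `l ↦ j_l`; the exponent only depends on the tail set); `g0Fund_smul` (degree `−n` homogeneity — the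
  hypothesis of Lemma 1); `g0Fund_cons_one` (at `z = (1, y)` it is the y-integrand displayed after (21), and equals `SectorIntegral`'s
  integrand `(∏_k (heppInv a k)^{D (rev k)})/∏_k a k` at `a = y ∘ rev`); and **`integral_simplexSectorChart_g0Fund`**:
  `∫_{simplexSectorChart m} g₀(1 − Σx, x) dx = ∏_i (D i)⁻¹` for every positive exponent vector — "(19) equals … 1/∏_{l=2}^{n} Deg({j_l,…,j_n})",
  now from the δ(Σz − 1) form, by Volkov's own route Lemma 1 → (21) → (22) (`SectorIntegral.integral_heppCube_sectorDensity`).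
* §6 (v2, additions only) THE SIMPLEX SECTOR IN SECTOR COORDINATES FOR AN ARBITRARY INTEGRAND — the measure-level content of
  "(21) then (22)" that the paper applies to `g₀` only: **`setIntegral_simplexSectorChart_eq_heppUnitBox`**
  `∫_{S_{1,…,n}} f δ(Σz − 1) dz = ∫_{(0,1]^{n−1}} (∏_k β_k^k)·(1 + Σ_i a_i)^{−n}·f((1, a∘rev)/(1 + Σ_i a_i)) dβ`, `a = heppMap β` (Lemma 1's
  Jacobian (20) composed with the relabelling and `Borinsky2020.integral_heppCube_eq_integral_heppUnitBox`), the matching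
  **`integrableOn_simplexSectorChart_iff`** (finiteness of any `δ(Σz − 1)` sector integral ⇔ finiteness on the unit box of sector variables
  with the two explicit Jacobian factors), and `one_add_sum_heppMap_mem_Icc` (`1 ≤ 1 + Σ_i a_i ≤ n` on the unit box: the normaliser factor is
  two-sided bounded, so it moves no exponent along any ray).
NOT typed here: the sum of (19) over all `n!` sectors (`= Σ_{a∈Λ} W(Λ∖{a})`, the discrete half — `FastSamplingTable.lean`'s `totalW`, A.19 of
the V3 notes); anything about `Deg` beyond positivity; Lemma 1 for sign-changing `1 + Σ y` (Volkov states `Y ⊆ ℝ^{n−1}` without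
restriction; the map is injective on `{1 + Σ y ≠ 0}` — `injOn_maxToSum` — but the determinant's sign and the homogeneity scalar then need
`|1 + Σ y|`, which no use in the paper requires).
-/

namespace Literature.MathematicalPhysics.QuantumFieldTheory.Volkov2017

open MeasureTheory Set Real
open Borinsky2020

variable {d : ℕ}

/-! ### §1 The map of Lemma 1 and its inverse -/

/-- **The map of Lemma 1** `(y₂,…,y_n) ↦ (y₂/(1+y₂+…+y_n), …, y_n/(1+y₂+…+y_n))` — the substitution (21) `z_{j_l} = y_l/(1+y₂+…+y_n)`
read on the last `n − 1` coordinates (from the chart "max coordinate `y₁ = 1`" to the chart "sum `= 1`").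
[cite: Volkov2017, §III.C Lemma 1 (`lemma_sum_to_max`) and eq. (21) `eq_subst_zy`] -/
noncomputable def maxToSum (y : Fin d → ℝ) : Fin d → ℝ := (1 + ∑ j, y j)⁻¹ • y

/-- Unfolding: `maxToSum y i = y_i/(1 + Σ y)`. [cite: Volkov2017, §III.C Lemma 1 (the map)] -/
theorem maxToSum_apply (y : Fin d → ℝ) (i : Fin d) : maxToSum y i = y i / (1 + ∑ j, y j) := by
  simp [maxToSum, div_eq_inv_mul]

/-- **The inverse map** `x ↦ x/(1 − x₂ − … − x_n)` (from the chart "sum `= 1`" back to "`y₁ = 1`": `y_l = z_{j_l}/z_{j₁}` with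
`z_{j₁} = 1 − Σ x`). [cite: Volkov2017, §III.C Lemma 1 with eq. (21) `eq_subst_zy` (y₁ = 1)] -/
noncomputable def sumToMax (x : Fin d → ℝ) : Fin d → ℝ := (1 - ∑ j, x j)⁻¹ • x

/-- Unfolding: `sumToMax x i = x_i/(1 − Σ x)`. [cite: Volkov2017, §III.C Lemma 1 with eq. (21)] -/
theorem sumToMax_apply (x : Fin d → ℝ) (i : Fin d) : sumToMax x i = x i / (1 - ∑ j, x j) := by
  simp [sumToMax, div_eq_inv_mul]

/-- `Σ_i x_i = (Σ y)/(1 + Σ y)` at `x = maxToSum y`. [cite: Volkov2017, §III.C proof of Lemma 1] -/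
theorem sum_maxToSum (y : Fin d → ℝ) : ∑ i, maxToSum y i = (∑ j, y j) / (1 + ∑ j, y j) := by
  simp_rw [maxToSum_apply, ← Finset.sum_div]

/-- `1 − x₂ − … − x_n = 1/(1 + y₂ + … + y_n)`: the first coordinate of the simplex point is the reciprocal of the normaliser
("the right part of (20) equals 1/(1+y₂+…+y_n)ⁿ" rests on this). [cite: Volkov2017, §III.C proof of Lemma 1, eq. (20) `eq_jacobian`] -/
theorem one_sub_sum_maxToSum {y : Fin d → ℝ} (hy : 1 + ∑ j, y j ≠ 0) :
    1 - ∑ i, maxToSum y i = (1 + ∑ j, y j)⁻¹ := by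
  rw [sum_maxToSum]
  field_simp
  ring

/-- `Σ_i y_i = (Σ x)/(1 − Σ x)` at `y = sumToMax x`. [cite: Volkov2017, §III.C Lemma 1 with eq. (21)] -/
theorem sum_sumToMax (x : Fin d → ℝ) : ∑ i, sumToMax x i = (∑ j, x j) / (1 - ∑ j, x j) := by
  simp_rw [sumToMax_apply, ← Finset.sum_div]

/-- `1 + Σ y = 1/(1 − Σ x)` at `y = sumToMax x`. [cite: Volkov2017, §III.C Lemma 1 with eq. (21)] -/
theorem one_add_sum_sumToMax {x : Fin d → ℝ} (hx : 1 - ∑ j, x j ≠ 0) :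
    1 + ∑ i, sumToMax x i = (1 - ∑ j, x j)⁻¹ := by
  rw [sum_sumToMax]
  field_simp
  ring

/-- `sumToMax` is a left inverse of `maxToSum` wherever `1 + Σ y ≠ 0`. [cite: Volkov2017, §III.C Lemma 1 (the substitution x_j = y_j/(1+y₂+…+y_n))] -/
theorem sumToMax_maxToSum {y : Fin d → ℝ} (hy : 1 + ∑ j, y j ≠ 0) : sumToMax (maxToSum y) = y := by
  ext i
  rw [sumToMax_apply, one_sub_sum_maxToSum hy, maxToSum_apply]
  field_simp

/-- `maxToSum` is a left inverse of `sumToMax` wherever `1 − Σ x ≠ 0`. [cite: Volkov2017, §III.C Lemma 1 with eq. (21)] -/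
theorem maxToSum_sumToMax {x : Fin d → ℝ} (hx : 1 - ∑ j, x j ≠ 0) : maxToSum (sumToMax x) = x := by
  ext i
  rw [maxToSum_apply, one_add_sum_sumToMax hx, sumToMax_apply]
  field_simp

/-- The map of Lemma 1 is injective on `{1 + Σ y ≠ 0}` (so the change of variables theorem applies on every `Y` inside it).
[cite: Volkov2017, §III.C proof of Lemma 1 ("To apply the change of variables theorem…")] -/
theorem injOn_maxToSum : InjOn (maxToSum (d := d)) {y | 1 + ∑ j, y j ≠ 0} := by
  intro y hy y' hy' h
  have h2 := congrArg (sumToMax (d := d)) h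
  rwa [sumToMax_maxToSum hy, sumToMax_maxToSum hy'] at h2

/-- **"X be the image of Y"**, computed: `maxToSum '' Y = {x | 1 − Σ x ≠ 0, x/(1 − Σ x) ∈ Y}` for `Y ⊆ {1 + Σ y ≠ 0}`.
[cite: Volkov2017, §III.C Lemma 1 (X the image of Y)] -/
theorem image_maxToSum {Y : Set (Fin d → ℝ)} (hY : Y ⊆ {y | 1 + ∑ j, y j ≠ 0}) :
    maxToSum '' Y = {x | 1 - ∑ j, x j ≠ 0 ∧ sumToMax x ∈ Y} := by
  ext x
  constructor
  · rintro ⟨y, hy, rfl⟩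
    refine ⟨?_, ?_⟩
    · rw [one_sub_sum_maxToSum (hY hy)]
      exact inv_ne_zero (hY hy)
    · rw [sumToMax_maxToSum (hY hy)]
      exact hy
  · rintro ⟨hx, hxY⟩
    exact ⟨sumToMax x, hxY, maxToSum_sumToMax hx⟩

/-- The same for `Y ⊆ {1 + Σ y > 0}` (Volkov's case, `Y` in the positive orthant): `maxToSum '' Y = {x | Σ x < 1, x/(1 − Σ x) ∈ Y}`.
[cite: Volkov2017, §III.C Lemma 1 (X the image of Y)] -/
theorem image_maxToSum_of_pos {Y : Set (Fin d → ℝ)} (hY : ∀ y ∈ Y, 0 < 1 + ∑ j, y j) :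
    maxToSum '' Y = {x | ∑ j, x j < 1 ∧ sumToMax x ∈ Y} := by
  rw [image_maxToSum fun y hy => (hY y hy).ne']
  ext x
  simp only [mem_setOf_eq]
  constructor
  · rintro ⟨hx, hxY⟩
    refine ⟨?_, hxY⟩
    have h := hY _ hxY
    rw [one_add_sum_sumToMax hx, inv_pos] at h
    linarith
  · rintro ⟨hx, hxY⟩
    exact ⟨by linarith, hxY⟩

/-- **The point identity behind (20)'s right-hand side**: at `x = maxToSum y` the simplex point `(1 − Σ x, x)` is the rescaled
affine-chart point `(1, y)/(1 + Σ y)` — so for `h` homogeneous of degree `−n`, `h(1 − Σx, x) = (1 + Σ y)ⁿ h(1, y)`.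
[cite: Volkov2017, §III.C proof of Lemma 1 ("The right part of (20) equals 1/(1+y₂+…+y_n)ⁿ")] -/
theorem cons_one_sub_sum_maxToSum {y : Fin d → ℝ} (hy : 1 + ∑ j, y j ≠ 0) :
    (Fin.cons (1 - ∑ i, maxToSum y i) (maxToSum y) : Fin (d + 1) → ℝ) = (1 + ∑ j, y j)⁻¹ • (Fin.cons 1 y : Fin (d + 1) → ℝ) := by
  ext i
  refine Fin.cases ?_ (fun k => ?_) i
  · simp [one_sub_sum_maxToSum hy]
  · simp [maxToSum]

/-! ### §2 The Jacobian (20) -/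

/-- The coordinate-sum functional `v ↦ Σ_i v_i` on `ℝ^{n−1}` as a continuous linear map (the differential of Volkov's normaliser
`y ↦ 1 + y₂ + … + y_n`; its composition with `y ↦ y` is the rank-one part `M″`). [cite: Volkov2017, §III.C proof of Lemma 1 (the matrix M″)] -/
noncomputable def coordSum (d : ℕ) : (Fin d → ℝ) →L[ℝ] ℝ := ∑ i : Fin d, ContinuousLinearMap.proj i

/-- Unfolding `coordSum`: `coordSum d v = Σ_i v_i`. [cite: Volkov2017, §III.C proof of Lemma 1 (the sum y₂ + … + y_n)] -/
@[simp] theorem coordSum_apply (v : Fin d → ℝ) : coordSum d v = ∑ i, v i := by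
  simp [coordSum]

/-- **Volkov's `M′ + M″`**: the Fréchet derivative of the map of Lemma 1 at `y`, `v ↦ v/(1 + Σ y) − (Σ v)·y/(1 + Σ y)²`
(`m′_{ij} = δ_{ij}/(1+y₂+…+y_n)`, `m″_{ij} = −y_i/(1+y₂+…+y_n)²`). [cite: Volkov2017, §III.C proof of Lemma 1 (the matrices M′, M″)] -/
noncomputable def maxToSumDeriv (y : Fin d → ℝ) : (Fin d → ℝ) →L[ℝ] (Fin d → ℝ) :=
  (1 + ∑ j, y j)⁻¹ • ContinuousLinearMap.id ℝ (Fin d → ℝ) +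
    ((-((1 + ∑ j, y j) ^ 2)⁻¹) • coordSum d).smulRight y

/-- `maxToSumDeriv` applied to a vector. [cite: Volkov2017, §III.C proof of Lemma 1 (the matrices M′, M″)] -/
theorem maxToSumDeriv_apply (y v : Fin d → ℝ) :
    maxToSumDeriv y v = (1 + ∑ j, y j)⁻¹ • v + (-((1 + ∑ j, y j) ^ 2)⁻¹ * ∑ i, v i) • y := by
  simp [maxToSumDeriv]

/-- **The map of Lemma 1 is differentiable with derivative `M′ + M″`** wherever `1 + Σ y ≠ 0`.
[cite: Volkov2017, §III.C proof of Lemma 1 (eq. (20) `eq_jacobian`, the Jacobian ∂(x₂,…,x_n)/∂(y₂,…,y_n))] -/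
theorem hasFDerivAt_maxToSum {y : Fin d → ℝ} (hy : 1 + ∑ j, y j ≠ 0) :
    HasFDerivAt (maxToSum (d := d)) (maxToSumDeriv y) y := by
  have h1 : HasFDerivAt (fun y' : Fin d → ℝ => 1 + coordSum d y') (coordSum d) y :=
    ((coordSum d).hasFDerivAt).const_add 1
  have h2 : HasDerivAt (fun t : ℝ => t⁻¹) (-((1 + ∑ j, y j) ^ 2)⁻¹) (1 + coordSum d y) := by
    rw [coordSum_apply]
    exact hasDerivAt_inv hy
  have h3 : HasFDerivAt (fun y' : Fin d → ℝ => (1 + coordSum d y')⁻¹) ((-((1 + ∑ j, y j) ^ 2)⁻¹) • coordSum d) y :=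
    h2.comp_hasFDerivAt y h1
  have h4 := h3.smul (hasFDerivAt_id (𝕜 := ℝ) y)
  refine (h4.congr_of_eventuallyEq (Filter.Eventually.of_forall fun y' => ?_)).congr_fderiv ?_
  · show maxToSum y' = (1 + coordSum d y')⁻¹ • id y'
    rw [coordSum_apply]
    rfl
  · ext v i
    simp [maxToSumDeriv]

/-- **"All rows of `M″` are collinear"**: the matrix of `M′ + M″` is `(1 + Σ y)⁻¹ • (1 + u ⊗ 𝟙)` with `u = −y/(1 + Σ y)` — a multiple of
the identity plus a rank-one matrix. [cite: Volkov2017, §III.C proof of Lemma 1 (d_l = 0 for l ≥ 2)] -/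
theorem toMatrix_maxToSumDeriv (y : Fin d → ℝ) :
    LinearMap.toMatrix' (maxToSumDeriv y : (Fin d → ℝ) →ₗ[ℝ] (Fin d → ℝ)) =
      (1 + ∑ j, y j)⁻¹ • (1 + Matrix.vecMulVec (-(1 + ∑ j, y j)⁻¹ • y) (fun _ => (1 : ℝ))) := by
  ext i j
  rw [LinearMap.toMatrix'_apply, ContinuousLinearMap.coe_coe, maxToSumDeriv_apply]
  simp only [Finset.sum_pi_single', Finset.mem_univ, if_true]
  simp only [Pi.add_apply, Pi.smul_apply, smul_eq_mul, Matrix.smul_apply, Matrix.add_apply, Matrix.one_apply,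
    Matrix.vecMulVec_apply, Pi.single_apply, mul_one]
  rw [← inv_pow]
  split_ifs <;> ring

/-- **(20): "`D = d₀ + d₁ = 1/(1+y₂+…+y_n)ⁿ`"** — the Jacobian determinant of the map of Lemma 1 (here via the rank-one determinant
lemma `det(1 + u ⊗ v) = 1 + v ⬝ u`, which is the content of Volkov's expansion `d₀ = (1+Σy)^{−(n−1)}`, `d₁ = −(Σy)(1+Σy)^{−n}`,
`d_l = 0` for `l ≥ 2`). [cite: Volkov2017, §III.C proof of Lemma 1, eq. (20) `eq_jacobian` ("D = d₀ + d₁ = 1/(1+y₂+…+y_n)ⁿ")] -/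
theorem det_maxToSumDeriv {y : Fin d → ℝ} (hy : 1 + ∑ j, y j ≠ 0) :
    (maxToSumDeriv y).det = ((1 + ∑ j, y j) ^ (d + 1))⁻¹ := by
  rw [ContinuousLinearMap.det, ← LinearMap.det_toMatrix', toMatrix_maxToSumDeriv, Matrix.det_smul,
    Matrix.vecMulVec_eq (Fin 1), Matrix.det_one_add_replicateCol_mul_replicateRow, Fintype.card_fin]
  simp only [dotProduct, Pi.smul_apply, smul_eq_mul, one_mul, ← Finset.mul_sum]
  have hmul : (1 + ∑ j, y j)⁻¹ * (1 + ∑ j, y j) = 1 := inv_mul_cancel₀ hy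
  have key : (1 : ℝ) + -(1 + ∑ j, y j)⁻¹ * ∑ j, y j = (1 + ∑ j, y j)⁻¹ := by linear_combination -hmul
  rw [key, ← pow_succ, inv_pow]

/-! ### §3 The change of variables: general integrands, integrability, and Lemma 1 as printed -/

/-- **The projective change of variables, general form**: for EVERY integrand `f` on `ℝⁿ` (`n = d + 1`) and every measurable
`Y ⊆ {1 + Σ y > 0}`, `∫_{maxToSum '' Y} f(1 − Σx, x) dx = ∫_Y ((1 + Σ y)ⁿ)⁻¹ • f((1, y)/(1 + Σ y)) dy` — the change of variables theorem
with the Jacobian (20); Lemma 1 is the case of `f` homogeneous of degree `−n`. (No integrability needed: both sides vanish together when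
`f` is not integrable.) [cite: Volkov2017, §III.C Lemma 1 (`lemma_sum_to_max`) with eq. (20) `eq_jacobian`] -/
theorem setIntegral_image_maxToSum {F : Type*} [NormedAddCommGroup F] [NormedSpace ℝ F]
    {Y : Set (Fin d → ℝ)} (hY : MeasurableSet Y) (hYpos : ∀ y ∈ Y, 0 < 1 + ∑ j, y j) (f : (Fin (d + 1) → ℝ) → F) :
    ∫ x in maxToSum '' Y, f (Fin.cons (1 - ∑ i, x i) x) =
      ∫ y in Y, ((1 + ∑ j, y j) ^ (d + 1))⁻¹ • f ((1 + ∑ j, y j)⁻¹ • (Fin.cons 1 y : Fin (d + 1) → ℝ)) := by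
  rw [integral_image_eq_integral_abs_det_fderiv_smul volume hY
      (fun y hy => (hasFDerivAt_maxToSum (hYpos y hy).ne').hasFDerivWithinAt)
      (injOn_maxToSum.mono fun y hy => (hYpos y hy).ne')]
  refine setIntegral_congr_fun hY fun y hy => ?_
  rw [det_maxToSumDeriv (hYpos y hy).ne', abs_of_pos (inv_pos.mpr (pow_pos (hYpos y hy) _)),
    cons_one_sub_sum_maxToSum (hYpos y hy).ne']

/-- **Integrability moves with the chart**: `f(1 − Σx, x)` is integrable on `maxToSum '' Y` iff `((1 + Σ y)ⁿ)⁻¹ • f((1, y)/(1 + Σ y))` is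
integrable on `Y` (so a FINITENESS statement about a `δ(Σz − 1)` integral is a statement in the affine chart and conversely).
[cite: Volkov2017, §III.C Lemma 1 (`lemma_sum_to_max`) with eq. (20) `eq_jacobian`] -/
theorem integrableOn_image_maxToSum_iff {F : Type*} [NormedAddCommGroup F] [NormedSpace ℝ F]
    {Y : Set (Fin d → ℝ)} (hY : MeasurableSet Y) (hYpos : ∀ y ∈ Y, 0 < 1 + ∑ j, y j) (f : (Fin (d + 1) → ℝ) → F) :
    IntegrableOn (fun x => f (Fin.cons (1 - ∑ i, x i) x)) (maxToSum '' Y) ↔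
      IntegrableOn (fun y => ((1 + ∑ j, y j) ^ (d + 1))⁻¹ • f ((1 + ∑ j, y j)⁻¹ • (Fin.cons 1 y : Fin (d + 1) → ℝ))) Y := by
  rw [integrableOn_image_iff_integrableOn_abs_det_fderiv_smul volume hY
      (fun y hy => (hasFDerivAt_maxToSum (hYpos y hy).ne').hasFDerivWithinAt)
      (injOn_maxToSum.mono fun y hy => (hYpos y hy).ne') (fun x => f (Fin.cons (1 - ∑ i, x i) x))]
  refine integrableOn_congr_fun (fun y hy => ?_) hY
  rw [det_maxToSumDeriv (hYpos y hy).ne', abs_of_pos (inv_pos.mpr (pow_pos (hYpos y hy) _)),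
    cons_one_sub_sum_maxToSum (hYpos y hy).ne']

/-- **LEMMA 1 (`lemma_sum_to_max`) AS PRINTED**: "Let Y ⊆ ℝ^{n−1}, X be the image of Y under the map (y₂,…,y_n) →
(y₂/(1+y₂+…+y_n), …, y_n/(1+y₂+…+y_n)), h : ℝⁿ → ℝ be a function satisfying h(kz) = h(z)/kⁿ. Then ∫_Y h(1,y₂,…,y_n) dy₂…dy_n =
∫_X h(1−x₂−…−x_n, x₂,…,x_n) dx₂…dx_n." Here with the implicit hypotheses explicit — `Y` measurable, `1 + Σ y > 0` on `Y`, and the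
homogeneity for `k > 0` at the points `(1, y)`, `y ∈ Y` (all that the proof uses). [cite: Volkov2017, §III.C Lemma 1 (`lemma_sum_to_max`)] -/
theorem integral_cons_one_eq_integral_image_maxToSum {Y : Set (Fin d → ℝ)} (hY : MeasurableSet Y)
    (hYpos : ∀ y ∈ Y, 0 < 1 + ∑ j, y j) {h : (Fin (d + 1) → ℝ) → ℝ}
    (hh : ∀ y ∈ Y, ∀ k : ℝ, 0 < k →
      h (k • (Fin.cons 1 y : Fin (d + 1) → ℝ)) = h (Fin.cons 1 y) / k ^ (d + 1)) :
    ∫ y in Y, h (Fin.cons 1 y) = ∫ x in maxToSum '' Y, h (Fin.cons (1 - ∑ i, x i) x) := by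
  rw [setIntegral_image_maxToSum hY hYpos h]
  refine setIntegral_congr_fun hY fun y hy => ?_
  have hc : (1 + ∑ j, y j) ^ (d + 1) ≠ 0 := pow_ne_zero _ (hYpos y hy).ne'
  simp only [smul_eq_mul]
  rw [hh y hy _ (inv_pos.mpr (hYpos y hy)), inv_pow, div_inv_eq_mul, ← mul_assoc, mul_comm _ (h _), mul_assoc,
    inv_mul_cancel₀ hc, mul_one]

/-- Lemma 1 with the homogeneity stated globally, as in the print ("h : ℝⁿ → ℝ be a function satisfying h(kz) = h(z)/kⁿ", `k > 0`).
[cite: Volkov2017, §III.C Lemma 1 (`lemma_sum_to_max`)] -/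
theorem integral_cons_one_eq_of_homogeneous {Y : Set (Fin d → ℝ)} (hY : MeasurableSet Y)
    (hYpos : ∀ y ∈ Y, 0 < 1 + ∑ j, y j) {h : (Fin (d + 1) → ℝ) → ℝ}
    (hh : ∀ (k : ℝ), 0 < k → ∀ z : Fin (d + 1) → ℝ, h (k • z) = h z / k ^ (d + 1)) :
    ∫ y in Y, h (Fin.cons 1 y) = ∫ x in maxToSum '' Y, h (Fin.cons (1 - ∑ i, x i) x) :=
  integral_cons_one_eq_integral_image_maxToSum hY hYpos fun _ _ k hk => hh k hk _

/-! ### §4 The sector: Volkov's `Y = {1 ≥ y₂ ≥ … ≥ y_n > 0}` and the simplex sector `S_{1,…,n}` in the `δ`-resolved chart -/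

variable {m : ℕ}

/-- **Volkov's `Y`** for a sector: `{1 ≥ y₂ ≥ y₃ ≥ … ≥ y_n > 0}` ⊆ ℝ^{n−1}, `n − 1 = m + 1`, in his order (`y 0 = y₂` the largest,
`y m = y_n` the smallest). [cite: Volkov2017, §III.C (display after eq. (21): "∫_{1 ≥ y₂ ≥ y₃ ≥ … ≥ y_n > 0} …")] -/
def sectorChartY (m : ℕ) : Set (Fin (m + 1) → ℝ) :=
  {y | (∀ j, 0 < y j) ∧ y 0 ≤ 1 ∧ ∀ i : Fin m, y i.succ ≤ y (Fin.castSucc i)}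

/-- Membership in `sectorChartY`. [cite: Volkov2017, §III.C (display after eq. (21))] -/
theorem mem_sectorChartY {y : Fin (m + 1) → ℝ} :
    y ∈ sectorChartY m ↔ (∀ j, 0 < y j) ∧ y 0 ≤ 1 ∧ ∀ i : Fin m, y i.succ ≤ y (Fin.castSucc i) := Iff.rfl

/-- **The integration domain of (19)** for the sector `S_{1,2,…,n} = {z₁ ≥ z₂ ≥ … ≥ z_n}` of the open orthant, with `δ(z₁+…+z_n − 1)`
resolved in `z₁`: the points `x = (z₂, …, z_n) ∈ ℝ^{n−1}` (`n − 1 = m + 1`) such that `(1 − Σ x, x)` is positive and decreasing.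
[cite: Volkov2017, §III.B (the sector S_{j₁,…,j_n}) and §III.C eq. (19) `eq_g0_integral`] -/
def simplexSectorChart (m : ℕ) : Set (Fin (m + 1) → ℝ) :=
  {x | (∀ j, 0 < (Fin.cons (1 - ∑ i, x i) x : Fin (m + 2) → ℝ) j) ∧
    ∀ i : Fin (m + 1), (Fin.cons (1 - ∑ i, x i) x : Fin (m + 2) → ℝ) i.succ ≤
      (Fin.cons (1 - ∑ i, x i) x : Fin (m + 2) → ℝ) (Fin.castSucc i)}

/-- Membership in `simplexSectorChart`, coordinates unfolded: all `x_j > 0`, `Σ x < 1`, `x 0 ≤ 1 − Σ x`, and `x` decreasing.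
[cite: Volkov2017, §III.B (the sector S_{j₁,…,j_n}) and §III.C eq. (19)] -/
theorem mem_simplexSectorChart {x : Fin (m + 1) → ℝ} :
    x ∈ simplexSectorChart m ↔
      (∑ i, x i < 1 ∧ ∀ j, 0 < x j) ∧ x 0 ≤ 1 - ∑ i, x i ∧ ∀ i : Fin m, x i.succ ≤ x (Fin.castSucc i) := by
  simp only [simplexSectorChart, mem_setOf_eq, Fin.forall_fin_succ, Fin.cons_zero, Fin.cons_succ, sub_pos,
    Fin.castSucc_zero, ← Fin.succ_castSucc]

/-- **"X, the image of Y", discharged for the sector**: the `δ`-resolved simplex sector IS the image of Volkov's `Y` under the map of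
Lemma 1 (so Lemma 1 applies to (19) exactly as the paper uses it: "Using the proved lemma and the substitution (21) … we obtain that (19)
equals ∫_{1 ≥ y₂ ≥ … ≥ y_n > 0} …"). [cite: Volkov2017, §III.C (Lemma 1 applied to eq. (19) via eq. (21) `eq_subst_zy`)] -/
theorem simplexSectorChart_eq_image : simplexSectorChart m = maxToSum '' sectorChartY m := by
  have hYpos : ∀ y ∈ sectorChartY m, 0 < 1 + ∑ j, y j := fun y hy =>
    add_pos_of_pos_of_nonneg one_pos (Finset.sum_nonneg fun j _ => (hy.1 j).le)
  rw [image_maxToSum_of_pos hYpos]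
  ext x
  rw [mem_simplexSectorChart, mem_setOf_eq, mem_sectorChartY]
  constructor
  · rintro ⟨⟨hsum, hpos⟩, h0, hdec⟩
    have hs : 0 < 1 - ∑ i, x i := sub_pos.mpr hsum
    refine ⟨hsum, fun j => ?_, ?_, fun i => ?_⟩
    · rw [sumToMax_apply]
      exact div_pos (hpos j) hs
    · rw [sumToMax_apply, div_le_one hs]
      exact h0
    · rw [sumToMax_apply, sumToMax_apply]
      exact div_le_div_of_nonneg_right (hdec i) hs.le
  · rintro ⟨hsum, hpos, h0, hdec⟩
    have hs : 0 < 1 - ∑ i, x i := sub_pos.mpr hsum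
    refine ⟨⟨hsum, fun j => ?_⟩, ?_, fun i => ?_⟩
    · have h := hpos j
      rw [sumToMax_apply] at h
      exact (div_pos_iff_of_pos_right hs).mp h
    · have h := h0
      rw [sumToMax_apply, div_le_one hs] at h
      exact h
    · have h := hdec i
      rw [sumToMax_apply, sumToMax_apply, div_le_div_iff_of_pos_right hs] at h
      exact h

/-- **Volkov's `Y` in the tree's Hepp convention**: `{1 ≥ y₂ ≥ … ≥ y_n > 0}` is the coordinate reversal of the cube sector
`{0 < a 0 ≤ a 1 ≤ ⋯ ≤ a m ≤ 1}` of `Borinsky2020/HeppSectorCoordinates` (`a k = y (rev k)`: smallest parameter first), the chart in which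
`SectorIntegral.lean` evaluated the y-integral. [cite: Volkov2017, §III.C (display after eq. (21))] -/
theorem sectorChartY_eq_preimage_heppCube :
    sectorChartY m = (permCoords (m := m) Fin.revPerm) ⁻¹' heppCube m := by
  ext y
  simp only [mem_preimage, coe_permCoords, heppCube, mem_setOf_eq, mem_heppSector, Function.comp_apply,
    Fin.revPerm_apply, Fin.rev_last, Fin.rev_castSucc, Fin.rev_succ, mem_sectorChartY]
  constructor
  · rintro ⟨hpos, h0, hdec⟩
    exact ⟨⟨fun j => hpos _, fun i => hdec (Fin.rev i)⟩, h0⟩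
  · rintro ⟨⟨hpos, hdec⟩, h0⟩
    refine ⟨fun j => by simpa using hpos (Fin.rev j), h0, fun i => by simpa using hdec (Fin.rev i)⟩

/-- `sectorChartY` is measurable. [cite: Volkov2017, §III.C (display after eq. (21))] -/
theorem measurableSet_sectorChartY : MeasurableSet (sectorChartY m) := by
  rw [sectorChartY_eq_preimage_heppCube]
  exact measurableSet_heppCube.preimage (permCoords _).measurable

/-- `simplexSectorChart` is measurable (the image of a measurable set under the injective differentiable map of Lemma 1).
[cite: Volkov2017, §III.C (Lemma 1 applied to eq. (19))] -/
theorem measurableSet_simplexSectorChart : MeasurableSet (simplexSectorChart m) := by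
  have hYpos : ∀ y ∈ sectorChartY m, 0 < 1 + ∑ j, y j := fun y hy =>
    add_pos_of_pos_of_nonneg one_pos (Finset.sum_nonneg fun j _ => (hy.1 j).le)
  rw [simplexSectorChart_eq_image]
  exact measurable_image_of_fderivWithin measurableSet_sectorChartY
    (fun y hy => (hasFDerivAt_maxToSum (hYpos y hy).ne').hasFDerivWithinAt)
    (injOn_maxToSum.mono fun y hy => (hYpos y hy).ne')

/-- **Relabelling the coordinates costs nothing**: `∫_{1 ≥ y₂ ≥ … ≥ y_n > 0} G(y) dy = ∫_{0 < a_0 ≤ ⋯ ≤ a_m ≤ 1} G(a ∘ rev) da`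
(Lebesgue measure is invariant under the reversal of coordinates, `Borinsky2020.measurePreserving_permCoords`).
[cite: Volkov2017, §III.C (display after eq. (21))] -/
theorem setIntegral_sectorChartY_eq_heppCube {F : Type*} [NormedAddCommGroup F] [NormedSpace ℝ F]
    (G : (Fin (m + 1) → ℝ) → F) :
    ∫ y in sectorChartY m, G y = ∫ a in heppCube m, G (a ∘ Fin.rev) := by
  have h := (measurePreserving_permCoords (m := m) Fin.revPerm).setIntegral_preimage_emb
    (permCoords Fin.revPerm).measurableEmbedding (fun a => G (a ∘ Fin.rev)) (heppCube m)
  rw [sectorChartY_eq_preimage_heppCube, ← h]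
  refine setIntegral_congr_fun (measurableSet_heppCube.preimage (permCoords _).measurable) fun y _ => ?_
  simp only [coe_permCoords]
  congr 1
  funext i
  simp

/-! ### §5 The evaluation of (19): `∫_{S_{1,…,n}} g₀ δ(Σz − 1) dz = 1/∏_l Deg` -/

/-- **(16) on the sector `S_{1,2,…,n}`**, as a function on all of `ℝⁿ` (`n = m + 2`, 0-based coordinates): `g₀(z) =
(∏_{i=0}^{n−2} (z_{i+1}/z_i)^{D i}) / (z_0 z_1 ⋯ z_{n−1})`, the ratio `z_{i+1}/z_i` (Volkov's `z_{j_l}/z_{j_{l−1}}`, `l = i + 2`) carrying the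
exponent `D i = Deg({j_l, …, j_n})` of the tail set of the `n − 1 − i` smallest parameters. [cite: Volkov2017, §III.B eq. (16) `eq_mc_g0`] -/
noncomputable def g0Fund (D : Fin (m + 1) → ℝ) (z : Fin (m + 2) → ℝ) : ℝ :=
  (∏ i : Fin (m + 1), (z i.succ / z (Fin.castSucc i)) ^ D i) / ∏ j, z j

/-- **`g₀` is homogeneous of degree `−n`** — the hypothesis "h(kz) = h(z)/kⁿ" of Lemma 1 for `h = g₀` (the ratios are scale invariant,
the denominator `z₁⋯z_n` has degree `n`). [cite: Volkov2017, §III.C Lemma 1 (hypothesis) with §III.B eq. (16)] -/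
theorem g0Fund_smul (D : Fin (m + 1) → ℝ) {k : ℝ} (hk : k ≠ 0) (z : Fin (m + 2) → ℝ) :
    g0Fund D (k • z) = g0Fund D z / k ^ (m + 2) := by
  simp only [g0Fund, Pi.smul_apply, smul_eq_mul]
  have h1 : ∀ i : Fin (m + 1), k * z i.succ / (k * z (Fin.castSucc i)) = z i.succ / z (Fin.castSucc i) := fun i =>
    mul_div_mul_left _ _ hk
  simp_rw [h1]
  rw [Finset.prod_mul_distrib, Finset.prod_const, Finset.card_univ, Fintype.card_fin, div_div, mul_comm]

/-- The ratios of `(1, y₂, …, y_n)` are Volkov's `t_l = y_l/y_{l−1}` (`y₁ = 1`), i.e. the tree's Hepp sector variables `heppInv` of the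
reversed point: `(1,y)_{i+1}/(1,y)_i = heppInv (y ∘ rev) (rev i)`. [cite: Volkov2017, §III.C eq. (22) `eq_subst_yt` (t_l = y_l/y_{l−1})] -/
theorem ratio_cons_one_eq_heppInv_rev (y : Fin (m + 1) → ℝ) (i : Fin (m + 1)) :
    (Fin.cons 1 y : Fin (m + 2) → ℝ) i.succ / (Fin.cons 1 y : Fin (m + 2) → ℝ) (Fin.castSucc i) =
      heppInv (y ∘ Fin.rev) (Fin.rev i) := by
  refine Fin.cases ?_ (fun k => ?_) i
  · rw [Fin.rev_zero, heppInv_last, Function.comp_apply, Fin.rev_last, Fin.castSucc_zero, Fin.cons_zero, Fin.cons_succ,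
      div_one]
  · rw [Fin.rev_succ, heppInv_castSucc, Function.comp_apply, Function.comp_apply, Fin.rev_castSucc, Fin.rev_succ,
      Fin.rev_rev, ← Fin.succ_castSucc]
    simp only [Fin.cons_succ]

/-- **At `z = (1, y)` the function `g₀` is the y-integrand displayed after (21)**, `∏_{l=2}^{n} (y_l/y_{l−1})^{Deg({j_l,…,j_n})}/(y₂…y_n)`,
and that integrand is `SectorIntegral.lean`'s `(∏_k (heppInv a k)^{D' k})/∏_k a k` at `a = y ∘ rev` with the exponent vector reversed,
`D' k = D (rev k)` (the ratio indexed by `i` from the top is the sector variable indexed by `rev i` from the bottom).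
[cite: Volkov2017, §III.C (display after eq. (21) `eq_subst_zy`, "where y₁ = 1")] -/
theorem g0Fund_cons_one (D : Fin (m + 1) → ℝ) (y : Fin (m + 1) → ℝ) :
    g0Fund D (Fin.cons 1 y) = (∏ k, heppInv (y ∘ Fin.rev) k ^ D (Fin.rev k)) / ∏ k, (y ∘ Fin.rev) k := by
  unfold g0Fund
  congr 1
  · refine Fintype.prod_equiv Fin.revPerm _ _ fun i => ?_
    rw [Fin.revPerm_apply, Fin.rev_rev, ratio_cons_one_eq_heppInv_rev]
  · rw [Fin.prod_univ_succ, Fin.cons_zero, one_mul]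
    simp only [Fin.cons_succ, Function.comp_apply]
    exact (Equiv.prod_comp Fin.revPerm y).symm

/-- **VOLKOV'S EVALUATION OF (19), FROM THE `δ(Σz − 1)` FORM**: for every positive exponent vector `D` ("Deg(s) > 0"),
`∫_{S_{1,…,n}, z > 0} g₀(z) δ(z₁+…+z_n − 1) dz = ∏_i (D i)⁻¹` — "(19) equals ∫_{1 ≥ y₂ ≥ … ≥ y_n > 0} ∏ (y_l/y_{l−1})^{Deg}/(y₂…y_n) dy
[Lemma 1 with (21)] … By the substitution (22) we obtain that it equals 1/∏_{l=2}^{n} Deg({j_l,j_{l+1},…,j_n})" — the second step being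
`SectorIntegral.integral_heppCube_sectorDensity`. (For the sector `S_{j₁,…,j_n}` relabel the lines `l ↦ j_l`; the value only depends on the
tail-set exponents.) [cite: Volkov2017, §III.C (evaluation of eq. (19) via Lemma 1, eq. (21) and eq. (22); arXiv PDF p.17)] -/
theorem integral_simplexSectorChart_g0Fund (D : Fin (m + 1) → ℝ) (hD : ∀ i, 0 < D i) :
    ∫ x in simplexSectorChart m, g0Fund D (Fin.cons (1 - ∑ i, x i) x) = ∏ i, (D i)⁻¹ := by
  have hYpos : ∀ y ∈ sectorChartY m, 0 < 1 + ∑ j, y j := fun y hy =>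
    add_pos_of_pos_of_nonneg one_pos (Finset.sum_nonneg fun j _ => (hy.1 j).le)
  rw [simplexSectorChart_eq_image,
    ← integral_cons_one_eq_integral_image_maxToSum measurableSet_sectorChartY hYpos
      (fun y _ k hk => g0Fund_smul D hk.ne' _)]
  simp_rw [g0Fund_cons_one]
  rw [setIntegral_sectorChartY_eq_heppCube (fun y => (∏ k, heppInv (y ∘ Fin.rev) k ^ D (Fin.rev k)) / ∏ k, (y ∘ Fin.rev) k)]
  have hcomp : ∀ a : Fin (m + 1) → ℝ, (a ∘ Fin.rev) ∘ Fin.rev = a := fun a => by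
    funext i
    simp
  simp_rw [hcomp]
  have h := integral_heppCube_sectorDensity (m := m) (D ∘ Fin.rev) fun k => hD _
  simp only [Function.comp_apply] at h
  rw [h]
  exact Fintype.prod_equiv Fin.revPerm _ _ fun k => rfl

/-! ### §6 The simplex sector in Hepp's sector coordinates: `δ(Σz − 1) dz|_{sector} = (1 + Σ_i a_i)^{−n} ∏_k β_k^k dβ` (A.26.3 (α) of the V3 notes) -/

/-- Reversing the order of summation: `Σ_j a_{rev j} = Σ_i a_i`. [cite: Volkov2017, §III.C eq. (21) `eq_subst_zy` (the normaliser 1+y₂+…+y_n)] -/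
theorem sum_comp_rev (a : Fin (m + 1) → ℝ) : ∑ j, (a ∘ Fin.rev) j = ∑ i, a i := by
  simp only [Function.comp_apply]
  exact Equiv.sum_comp Fin.revPerm a

/-- **The normaliser is harmless on the sector**: for sector variables in the unit box, `1 ≤ 1 + Σ_i a_i ≤ n` (`a = heppMap β`, each
`a_i = ∏_{j≥i} β_j ∈ (0, 1]`), so the factor `(1 + Σ_i a_i)^{−n}` of the simplex measure is two-sided bounded by `n^{−n}` and `1` and changes
no exponent along any ray. [cite: Volkov2017, §III.C eq. (21) `eq_subst_zy` (the normaliser 1+y₂+…+y_n on 1 ≥ y₂ ≥ … ≥ y_n > 0)] -/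
theorem one_add_sum_heppMap_mem_Icc {β : Fin (m + 1) → ℝ} (hβ : β ∈ heppUnitBox m) :
    1 + ∑ i, heppMap β i ∈ Icc (1 : ℝ) (m + 2) := by
  have h0 : ∀ i, 0 ≤ heppMap β i := fun i => (heppMap_pos (fun j => (hβ j).1) i).le
  have h1 : ∀ i, heppMap β i ≤ 1 := fun i =>
    Finset.prod_le_one (fun j _ => (hβ j).1.le) fun j _ => (hβ j).2
  refine ⟨le_add_of_nonneg_right (Finset.sum_nonneg fun i _ => h0 i), ?_⟩
  have hs : ∑ i, heppMap β i ≤ ∑ _i : Fin (m + 1), (1 : ℝ) := Finset.sum_le_sum fun i _ => h1 i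
  rw [Finset.sum_const, Finset.card_univ, Fintype.card_fin, nsmul_eq_mul, mul_one] at hs
  push_cast at hs ⊢
  linarith

/-- **The simplex sector in sector coordinates, for an ARBITRARY integrand** (no homogeneity): composing Lemma 1's change of variables
(Jacobian (20)) with the relabelling `y = a ∘ rev` and Hepp's `a = heppMap β` (Jacobian `∏_k β_k^k`, `Borinsky2020.integral_heppCube_eq_integral_heppUnitBox`),
`∫_{S_{1,…,n}} f(z) δ(Σz − 1) dz = ∫_{β ∈ (0,1]^{n−1}} (∏_k β_k^k) · (1 + Σ_i a_i)^{−n} · f((1, a ∘ rev)/(1 + Σ_i a_i)) dβ` with `a = heppMap β`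
(`a_i = ∏_{j ≥ i} β_j`; `1 + Σ_i a_i = 1 + t₂ + t₂t₃ + … + t₂⋯t_n` in Volkov's ratios (22)) — the measure-level content of "(21) then (22)"
that the paper applies to `g₀` only. [cite: Volkov2017, §III.C (Lemma 1 with eqs. (21) `eq_subst_zy` and (22) `eq_subst_yt`)] -/
theorem setIntegral_simplexSectorChart_eq_heppUnitBox {F : Type*} [NormedAddCommGroup F] [NormedSpace ℝ F]
    (f : (Fin (m + 2) → ℝ) → F) :
    ∫ x in simplexSectorChart m, f (Fin.cons (1 - ∑ i, x i) x) =
      ∫ β in heppUnitBox m, (∏ k : Fin (m + 1), β k ^ (k : ℕ)) •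
        (((1 + ∑ i, heppMap β i) ^ (m + 2))⁻¹ •
          f ((1 + ∑ i, heppMap β i)⁻¹ • (Fin.cons 1 (heppMap β ∘ Fin.rev) : Fin (m + 2) → ℝ))) := by
  have hYpos : ∀ y ∈ sectorChartY m, 0 < 1 + ∑ j, y j := fun y hy =>
    add_pos_of_pos_of_nonneg one_pos (Finset.sum_nonneg fun j _ => (hy.1 j).le)
  rw [simplexSectorChart_eq_image, setIntegral_image_maxToSum measurableSet_sectorChartY hYpos f,
    setIntegral_sectorChartY_eq_heppCube, integral_heppCube_eq_integral_heppUnitBox]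
  refine setIntegral_congr_fun measurableSet_heppUnitBox fun β _ => ?_
  rw [sum_comp_rev]

/-- **… and the matching integrability statement**: `f(z) δ(Σz − 1)` is integrable over the sector `S_{1,…,n}` iff
`(∏_k β_k^k) (1 + Σ_i a_i)^{−n} f((1, a ∘ rev)/(1 + Σ_i a_i))`, `a = heppMap β`, is integrable over the unit box `(0,1]^{n−1}` — so every
FINITENESS question about a `δ(Σz − 1)` sector integral (a mean, a second moment `∫ I²/g`) is a question on the unit box of sector variables
with these two explicit Jacobian factors. [cite: Volkov2017, §III.C (Lemma 1 with eqs. (21) `eq_subst_zy` and (22) `eq_subst_yt`)] -/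
theorem integrableOn_simplexSectorChart_iff {F : Type*} [NormedAddCommGroup F] [NormedSpace ℝ F]
    (f : (Fin (m + 2) → ℝ) → F) :
    IntegrableOn (fun x => f (Fin.cons (1 - ∑ i, x i) x)) (simplexSectorChart m) ↔
      IntegrableOn (fun β => (∏ k : Fin (m + 1), β k ^ (k : ℕ)) •
        (((1 + ∑ i, heppMap β i) ^ (m + 2))⁻¹ •
          f ((1 + ∑ i, heppMap β i)⁻¹ • (Fin.cons 1 (heppMap β ∘ Fin.rev) : Fin (m + 2) → ℝ)))) (heppUnitBox m) := by
  have hYpos : ∀ y ∈ sectorChartY m, 0 < 1 + ∑ j, y j := fun y hy =>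
    add_pos_of_pos_of_nonneg one_pos (Finset.sum_nonneg fun j _ => (hy.1 j).le)
  -- Lemma 1's chart: the simplex sector ↔ Volkov's Y
  rw [simplexSectorChart_eq_image, integrableOn_image_maxToSum_iff measurableSet_sectorChartY hYpos f]
  -- the relabelling y = a ∘ rev: Y ↔ the cube sector
  set G : (Fin (m + 1) → ℝ) → F := fun y =>
    ((1 + ∑ j, y j) ^ (m + 1 + 1))⁻¹ • f ((1 + ∑ j, y j)⁻¹ • (Fin.cons 1 y : Fin (m + 1 + 1) → ℝ)) with hG
  have hpre := (measurePreserving_permCoords (m := m) Fin.revPerm).integrableOn_comp_preimage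
    (permCoords Fin.revPerm).measurableEmbedding (f := fun a => G (a ∘ Fin.rev)) (s := heppCube m)
  have hcomp : ((fun a : Fin (m + 1) → ℝ => G (a ∘ Fin.rev)) ∘ ⇑(permCoords (m := m) Fin.revPerm)) = G := by
    funext y
    simp only [Function.comp_apply, coe_permCoords]
    congr 1
    funext i
    simp
  rw [hcomp, ← sectorChartY_eq_preimage_heppCube] at hpre
  rw [hpre]
  -- Hepp's coordinates: the cube sector ↔ the unit box
  rw [← image_heppMap_heppUnitBox,
    integrableOn_image_iff_integrableOn_abs_det_fderiv_smul volume measurableSet_heppUnitBox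
      (fun β _ => (hasFDerivAt_heppMap β).hasFDerivWithinAt) (injOn_heppMap.mono heppUnitBox_subset_heppBox)]
  refine integrableOn_congr_fun (fun β hβ => ?_) measurableSet_heppUnitBox
  rw [abs_of_pos (det_heppDeriv_pos fun j => (hβ j).1), det_heppDeriv, hG]
  simp only [sum_comp_rev]

end Literature.MathematicalPhysics.QuantumFieldTheory.Volkov2017
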